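import Mathlib.LinearAlgebra.Matrix.GeneralLinearGroup.Defs
import Mathlib.LinearAlgebra.Matrix.Block
import Mathlib.Data.Matrix.Block
import Literature.Computability.AlgebraicComplexity.DeterminantalComplexity
import HarnessLib

/-!
# Block-decomposable matrices of polynomials (constant two-sided base change)

Topic `Literature/Computability/AlgebraicComplexity`; definition request `defn-IsBlockDecomposable`
of route ValiantsHypothesis/GrenetRigidity (item `WindowStability`, stmt-ValiantsHypothesis-3734,
which inlines the predicate verbatim; consumed by `LaplaceBootstrap`, stmt-3736).

A square matrix `A` of polynomials (in practice of affine linear forms: an affine determinantal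
representation, `IsAffineDetRepr f A` of `DeterminantalComplexity.lean`) is BLOCK-DECOMPOSABLE if a
CONSTANT two-sided change of bases `A ↦ P A Q`, `P, Q ∈ GL_m(k)`, makes it block upper triangular
with two non-empty diagonal blocks: for some `0 < r < m` every entry in the rows `i ≥ r` and
columns `j < r` of `P A Q` vanishes.  Equivalently (basis-free), there are subspaces
`V, W ≤ k^m` of the same dimension `r`, `0 < r < m`, with `A(x) V ⊆ W` for every point `x` — the
matrix pencil / Kronecker-module viewpoint in which `(V, W)` is a proper subrepresentation; the
symmetry group `GL_m × GL_m` acting here is the stabiliser of `det_m` up to transposition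
(Landsberg–Ressayre 2017, §1: `G_{det_n} ≅ (GL_n × GL_n)/ℂ* ⋊ ℤ₂`), and equivalence of
determinantal representations under it is the notion of Hüttenhain–Ikenmeyer 2016, §4.

## Contents (everything proved; no named facts)

* `IsBlockDecomposable A` — the predicate, VERBATIM the inline text of `WindowStability`
  (`isBlockDecomposable_iff`);
* `IsBlockDecomposable.two_le` — a decomposable matrix has size `m ≥ 2`;
* `IsBlockDecomposable.of_corner_eq_zero` — a matrix that is already block upper triangular in
  the given coordinates is decomposable (`P = Q = 1`);
* `IsBlockDecomposable.baseChange` / `isBlockDecomposable_baseChange_iff` — invariance under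
  constant base changes `A ↦ P' A Q'`;
* `isBlockDecomposable_padding` — the padding `A ⊕ 1_c` used by `HasDetRepr.mono`
  (`reindex finSumFinEquiv finSumFinEquiv (fromBlocks A 0 0 1)`) is decomposable (`m, c ≥ 1`);
* `det_baseChange` — `det (P A Q) = C(det P · det Q) · det A` (a unit multiple);
* `det_eq_mul_det_of_corner_eq_zero` — a block upper triangular matrix has
  `det = det(block₁) · det(block₂)` (`Matrix.det_fromBlocks_zero₂₁` after reindexing
  `Fin m ≃ Fin r ⊕ Fin (m - r)`), whence `IsBlockDecomposable.exists_det_eq`: for a decomposable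
  `A`, `C(u) · det A = det B₁ · det B₂` for a unit `u` of `k` and the two diagonal blocks
  `B₁` (`r × r`), `B₂` (`(m-r) × (m-r)`) of `P A Q`.

## What is NOT here

The basis-free reformulation as a Lean theorem (subspaces `V`, `W`), and "a decomposable affine
representation of an IRREDUCIBLE `f` contains a smaller one" (one diagonal block is, up to a unit,
an affine determinantal representation of `f`, the other has constant determinant; needs unique
factorisation in `MvPolynomial` and the degree bookkeeping of the blocks) — requested API items
(i), (iii), left to a sibling proofs file.

## References (context; the notion is standard linear algebra of matrix pencils)

* B. Grenet, *An upper bound for the permanent versus determinant problem* (2011). [Grenet2011]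
* J. Hüttenhain, C. Ikenmeyer, *Binary determinantal complexity*, Linear Algebra Appl. 504
  (2016), §4. [HuttenhainIkenmeyer2016]
* J. M. Landsberg, N. Ressayre, *Permanent v. determinant: an exponential lower bound assuming
  symmetry and a potential path towards Valiant's conjecture*, Differential Geom. Appl. 55 (2017),
  §1. [LandsbergRessayre2017]
* T. Mignon, N. Ressayre, IMRN 2004, §1 (affine determinantal representations, padding).
  [MignonRessayre2004]
-/

noncomputable section

open MvPolynomial Matrix

namespace Literature.Computability.AlgebraicComplexity

variable {k : Type*} [CommRing k] {σ : Type*} {m : ℕ}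

/-! ### The predicate -/

/-- `IsBlockDecomposable A`: the `m × m` matrix `A` of polynomials is BLOCK UPPER TRIANGULARISABLE
BY A CONSTANT TWO-SIDED BASE CHANGE with two non-empty diagonal blocks: there are
`P, Q ∈ GL_m(k)` and `0 < r < m` such that `(P A Q)_{ij} = 0` whenever `i ≥ r > j` (constants act
through `MvPolynomial.C`).  Verbatim the predicate inlined in item `WindowStability` of route
ValiantsHypothesis/GrenetRigidity.  (Equivalently: a proper non-zero pair of constant subspaces
`V, W ≤ k^m` of equal dimension with `A(x)V ⊆ W` for all `x` — a subrepresentation of the matrix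
pencil; the acting group `GL_m × GL_m` is the identity component of the stabiliser of `det_m`,
Landsberg–Ressayre 2017, §1.) [cite: LandsbergRessayre2017, §1] -/
def IsBlockDecomposable (A : Matrix (Fin m) (Fin m) (MvPolynomial σ k)) : Prop :=
  ∃ (P Q : GL (Fin m) k) (r : ℕ), 0 < r ∧ r < m ∧ ∀ i j : Fin m, r ≤ (i : ℕ) → (j : ℕ) < r →
    ((P : Matrix (Fin m) (Fin m) k).map MvPolynomial.C * A *
      (Q : Matrix (Fin m) (Fin m) k).map MvPolynomial.C : Matrix (Fin m) (Fin m) (MvPolynomial σ k))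
        i j = 0

/-- Unfolding `IsBlockDecomposable` (the inline text of `WindowStability`).
[cite: LandsbergRessayre2017, §1] -/
theorem isBlockDecomposable_iff (A : Matrix (Fin m) (Fin m) (MvPolynomial σ k)) :
    IsBlockDecomposable A ↔
      ∃ (P Q : GL (Fin m) k) (r : ℕ), 0 < r ∧ r < m ∧ ∀ i j : Fin m, r ≤ (i : ℕ) → (j : ℕ) < r →
        ((P : Matrix (Fin m) (Fin m) k).map MvPolynomial.C * A *
          (Q : Matrix (Fin m) (Fin m) k).map MvPolynomial.C :
            Matrix (Fin m) (Fin m) (MvPolynomial σ k)) i j = 0 :=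
  Iff.rfl

/-- Both diagonal blocks are non-empty, so a decomposable matrix has size at least `2`.
[folklore] -/
theorem IsBlockDecomposable.two_le {A : Matrix (Fin m) (Fin m) (MvPolynomial σ k)}
    (h : IsBlockDecomposable A) : 2 ≤ m := by
  obtain ⟨-, -, r, hr, hrm, -⟩ := h
  omega

/-- Constant base change written out: `(P A Q)_{ij} = ∑_{a,b} P_{ia} Q_{bj} · A_{ab}`… we only need
that the constant matrices act through the ring map `C`; the identity acts trivially. [folklore] -/
theorem map_C_one : ((1 : Matrix (Fin m) (Fin m) k).map MvPolynomial.C :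
    Matrix (Fin m) (Fin m) (MvPolynomial σ k)) = 1 :=
  Matrix.map_one _ (map_zero _) (map_one _)

/-- A matrix which is ALREADY block upper triangular in the given coordinates (`A_{ij} = 0` for
`i ≥ r > j`, `0 < r < m`) is block-decomposable (`P = Q = 1`). [folklore] -/
theorem IsBlockDecomposable.of_corner_eq_zero {A : Matrix (Fin m) (Fin m) (MvPolynomial σ k)}
    {r : ℕ} (hr : 0 < r) (hrm : r < m)
    (h : ∀ i j : Fin m, r ≤ (i : ℕ) → (j : ℕ) < r → A i j = 0) : IsBlockDecomposable A := by
  refine ⟨1, 1, r, hr, hrm, fun i j hi hj => ?_⟩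
  rw [Units.val_one, map_C_one, one_mul, mul_one]
  exact h i j hi hj

/-- Composition of constant base changes: `P (P' A Q') Q = (P P') A (Q' Q)`. [folklore] -/
theorem map_C_mul_baseChange (P P' Q' Q : Matrix (Fin m) (Fin m) k)
    (A : Matrix (Fin m) (Fin m) (MvPolynomial σ k)) :
    P.map MvPolynomial.C * (P'.map MvPolynomial.C * A * Q'.map MvPolynomial.C) *
        Q.map MvPolynomial.C =
      (P * P').map MvPolynomial.C * A * (Q' * Q).map MvPolynomial.C := by
  rw [Matrix.map_mul, Matrix.map_mul]
  simp only [Matrix.mul_assoc]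

/-- INVARIANCE UNDER CONSTANT BASE CHANGE: if `A` is block-decomposable then so is `P' A Q'` for
all `P', Q' ∈ GL_m(k)` (use `P P'⁻¹` and `Q'⁻¹ Q`). [folklore] -/
theorem IsBlockDecomposable.baseChange {A : Matrix (Fin m) (Fin m) (MvPolynomial σ k)}
    (h : IsBlockDecomposable A) (P' Q' : GL (Fin m) k) :
    IsBlockDecomposable ((P' : Matrix (Fin m) (Fin m) k).map MvPolynomial.C * A *
      (Q' : Matrix (Fin m) (Fin m) k).map MvPolynomial.C) := by
  obtain ⟨P, Q, r, hr, hrm, hPQ⟩ := h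
  refine ⟨P * P'⁻¹, Q'⁻¹ * Q, r, hr, hrm, fun i j hi hj => ?_⟩
  -- work at the level of matrices (no entry evaluation under the rewrites)
  have hmat : ((P * P'⁻¹ : GL (Fin m) k) : Matrix (Fin m) (Fin m) k).map MvPolynomial.C *
      ((P' : Matrix (Fin m) (Fin m) k).map MvPolynomial.C * A *
        (Q' : Matrix (Fin m) (Fin m) k).map MvPolynomial.C) *
      ((Q'⁻¹ * Q : GL (Fin m) k) : Matrix (Fin m) (Fin m) k).map MvPolynomial.C =
      (P : Matrix (Fin m) (Fin m) k).map MvPolynomial.C * A *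
        (Q : Matrix (Fin m) (Fin m) k).map MvPolynomial.C := by
    rw [Units.val_mul, Units.val_mul, map_C_mul_baseChange,
      Matrix.mul_assoc (P : Matrix (Fin m) (Fin m) k), Units.inv_mul, Matrix.mul_one,
      ← Matrix.mul_assoc (Q' : Matrix (Fin m) (Fin m) k), Units.mul_inv, Matrix.one_mul]
  exact (congrFun (congrFun hmat i) j).trans (hPQ i j hi hj)

/-- Block-decomposability is a property of the `GL_m × GL_m`-orbit: `P' A Q'` is decomposable iff
`A` is. [folklore] -/
theorem isBlockDecomposable_baseChange_iff (A : Matrix (Fin m) (Fin m) (MvPolynomial σ k))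
    (P' Q' : GL (Fin m) k) :
    IsBlockDecomposable ((P' : Matrix (Fin m) (Fin m) k).map MvPolynomial.C * A *
      (Q' : Matrix (Fin m) (Fin m) k).map MvPolynomial.C) ↔ IsBlockDecomposable A := by
  refine ⟨fun h => ?_, fun h => h.baseChange P' Q'⟩
  have h' := h.baseChange P'⁻¹ Q'⁻¹
  rwa [map_C_mul_baseChange, Units.inv_mul, Units.mul_inv, map_C_one, Matrix.one_mul,
    Matrix.mul_one] at h'

/-! ### Padding is decomposable -/

/-- THE PADDING `A ⊕ 1_c` IS DECOMPOSABLE: the block-diagonal matrix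
`reindex finSumFinEquiv finSumFinEquiv (fromBlocks A 0 0 1)` of size `m + c` (the padding used by
`HasDetRepr.mono_holds`) is block upper (indeed block diagonal) triangular with corner `r = m`,
hence block-decomposable as soon as both blocks are non-empty (`0 < m`, `0 < c`).  In particular
the padded representations `HasDetRepr.mono` produces are never indecomposable. [folklore] -/
theorem isBlockDecomposable_padding (A : Matrix (Fin m) (Fin m) (MvPolynomial σ k)) {c : ℕ}
    (hm : 0 < m) (hc : 0 < c) :
    IsBlockDecomposable (Matrix.reindex finSumFinEquiv finSumFinEquiv
      (Matrix.fromBlocks A 0 0 (1 : Matrix (Fin c) (Fin c) (MvPolynomial σ k)))) := by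
  refine IsBlockDecomposable.of_corner_eq_zero hm (by omega) fun i j hi hj => ?_
  rw [Matrix.reindex_apply, Matrix.submatrix_apply]
  -- `i = natAdd m i'` lies in the second block of rows, `j = castAdd c j'` in the first block of
  -- columns, so the entry is in the zero lower-left block.
  obtain ⟨i', rfl⟩ : ∃ i' : Fin c, Fin.natAdd m i' = i :=
    ⟨⟨i - m, by omega⟩, Fin.ext (by simp; omega)⟩
  obtain ⟨j', rfl⟩ : ∃ j' : Fin m, Fin.castAdd c j' = j := ⟨⟨j, hj⟩, Fin.ext rfl⟩
  rw [finSumFinEquiv_symm_apply_natAdd, finSumFinEquiv_symm_apply_castAdd,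
    Matrix.fromBlocks_apply₂₁]
  rfl

/-! ### The determinant of a decomposable matrix factors -/

/-- The determinant changes by a unit constant under constant base change:
`det (P A Q) = C(det P · det Q) · det A`. [folklore] -/
theorem det_baseChange (P Q : Matrix (Fin m) (Fin m) k)
    (A : Matrix (Fin m) (Fin m) (MvPolynomial σ k)) :
    (P.map MvPolynomial.C * A * Q.map MvPolynomial.C).det =
      MvPolynomial.C (P.det * Q.det) * A.det := by
  rw [Matrix.det_mul, Matrix.det_mul, map_mul]
  have hP : (P.map MvPolynomial.C : Matrix (Fin m) (Fin m) (MvPolynomial σ k)).det =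
      MvPolynomial.C P.det := ((MvPolynomial.C : k →+* MvPolynomial σ k).map_det P).symm
  have hQ : (Q.map MvPolynomial.C : Matrix (Fin m) (Fin m) (MvPolynomial σ k)).det =
      MvPolynomial.C Q.det := ((MvPolynomial.C : k →+* MvPolynomial σ k).map_det Q).symm
  rw [hP, hQ]
  ring

/-- The splitting `Fin m ≃ Fin r ⊕ Fin (m - r)` of the index set at the corner `r ≤ m` (first `r`
indices, then the remaining `m - r`). [folklore] -/
def cornerEquiv (r m : ℕ) (hrm : r ≤ m) : Fin r ⊕ Fin (m - r) ≃ Fin m :=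
  finSumFinEquiv.trans (finCongr (Nat.add_sub_cancel' hrm))

/-- The first block of indices consists of the indices `< r`. [folklore] -/
@[simp] theorem cornerEquiv_inl_val {r m : ℕ} (hrm : r ≤ m) (i : Fin r) :
    ((cornerEquiv r m hrm (Sum.inl i) : Fin m) : ℕ) = i := by
  simp [cornerEquiv]

/-- The second block of indices consists of the indices `≥ r`. [folklore] -/
@[simp] theorem cornerEquiv_inr_val {r m : ℕ} (hrm : r ≤ m) (i : Fin (m - r)) :
    ((cornerEquiv r m hrm (Sum.inr i) : Fin m) : ℕ) = r + i := by
  simp [cornerEquiv]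

/-- A BLOCK UPPER TRIANGULAR MATRIX HAS `det = det(block₁) · det(block₂)`: if `B_{ij} = 0` for
`i ≥ r > j` then `det B` is the product of the determinants of the upper-left `r × r` block and
the lower-right `(m-r) × (m-r)` block (reindex along `cornerEquiv` and apply
`Matrix.det_fromBlocks_zero₂₁`). [folklore] -/
theorem det_eq_mul_det_of_corner_eq_zero {R : Type*} [CommRing R] {r : ℕ} (hrm : r ≤ m)
    (B : Matrix (Fin m) (Fin m) R) (h : ∀ i j : Fin m, r ≤ (i : ℕ) → (j : ℕ) < r → B i j = 0) :
    B.det =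
      (B.submatrix (fun i => cornerEquiv r m hrm (Sum.inl i)) fun j =>
          cornerEquiv r m hrm (Sum.inl j)).det *
        (B.submatrix (fun i => cornerEquiv r m hrm (Sum.inr i)) fun j =>
          cornerEquiv r m hrm (Sum.inr j)).det := by
  set e := cornerEquiv r m hrm with he
  have hB : B.det = (B.submatrix e e).det := by
    rw [← Matrix.det_reindex_self e.symm B]
    rfl
  rw [hB, ← Matrix.fromBlocks_toBlocks (B.submatrix e e)]
  have h21 : (B.submatrix e e).toBlocks₂₁ = 0 := by
    ext i j
    simp only [Matrix.toBlocks₂₁, Matrix.submatrix_apply, Matrix.of_apply, Matrix.zero_apply]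
    exact h _ _ (by rw [he, cornerEquiv_inr_val]; omega)
      (by rw [he, cornerEquiv_inl_val]; exact j.2)
  rw [h21, Matrix.det_fromBlocks_zero₂₁]
  rfl

/-- **A decomposable matrix has a factored determinant**: if `A` is block-decomposable, with
base change `P, Q` and corner `r`, then for the two diagonal blocks `B₁` (`r × r`) and `B₂`
(`(m-r) × (m-r)`) of `B = P A Q` one has `det B₁ · det B₂ = det B = C(det P · det Q) · det A`,
a UNIT constant multiple of `det A`.  (For an affine determinantal representation of an
irreducible `f` this is the starting point of "a decomposable representation contains a smaller
one".) [folklore] -/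
theorem IsBlockDecomposable.exists_det_eq {A : Matrix (Fin m) (Fin m) (MvPolynomial σ k)}
    (h : IsBlockDecomposable A) :
    ∃ (P Q : GL (Fin m) k) (r : ℕ) (hrm : r ≤ m), 0 < r ∧ r < m ∧
      (∀ i j : Fin m, r ≤ (i : ℕ) → (j : ℕ) < r →
        ((P : Matrix (Fin m) (Fin m) k).map MvPolynomial.C * A *
          (Q : Matrix (Fin m) (Fin m) k).map MvPolynomial.C :
            Matrix (Fin m) (Fin m) (MvPolynomial σ k)) i j = 0) ∧
      IsUnit (MvPolynomial.C
        ((P : Matrix (Fin m) (Fin m) k).det * (Q : Matrix (Fin m) (Fin m) k).det) :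
          MvPolynomial σ k) ∧
      MvPolynomial.C ((P : Matrix (Fin m) (Fin m) k).det * (Q : Matrix (Fin m) (Fin m) k).det) *
          A.det =
        (((P : Matrix (Fin m) (Fin m) k).map MvPolynomial.C * A *
            (Q : Matrix (Fin m) (Fin m) k).map MvPolynomial.C).submatrix
            (fun i => cornerEquiv r m hrm (Sum.inl i))
            fun j => cornerEquiv r m hrm (Sum.inl j)).det *
        (((P : Matrix (Fin m) (Fin m) k).map MvPolynomial.C * A *
            (Q : Matrix (Fin m) (Fin m) k).map MvPolynomial.C).submatrix
            (fun i => cornerEquiv r m hrm (Sum.inr i))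
            fun j => cornerEquiv r m hrm (Sum.inr j)).det := by
  obtain ⟨P, Q, r, hr, hrm, hPQ⟩ := h
  refine ⟨P, Q, r, hrm.le, hr, hrm, hPQ, ?_, ?_⟩
  · refine (IsUnit.mul ?_ ?_).map MvPolynomial.C
    · exact (Matrix.isUnit_iff_isUnit_det _).1 P.isUnit
    · exact (Matrix.isUnit_iff_isUnit_det _).1 Q.isUnit
  · rw [← det_baseChange, det_eq_mul_det_of_corner_eq_zero hrm.le _ hPQ]

end Literature.Computability.AlgebraicComplexity

end
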